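import Summits.NavierStokesRegularity.NavierStokesRegularity.Theorems.StrainDoorsSliceAlignedOffSmallSet
import Summits.NavierStokesRegularity.NavierStokesRegularity.Theorems.StrainDoorsDoorXClosed
import HarnessLib

/-!
# Strain doors, PART M §M34(d) — DOOR Z CLOSED; the absolute-level form; the every-time DIRECTIONAL-DISORDER
# floor at a sup-Type-I singularity

Completion of ROUND 72 §4 of the `ns-regularity-ideate` p1 line (helper lane of
`stmt-NavierStokesRegularity-0056`, rung N0; nothing here is a claim about Navier–Stokes regularity).  Door Z (`SliceAlignedOffSmallSetNotSingular`, PART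
`StrainDoorsSliceAlignedOffSmallSet`) composed with the closed door X (`sliceL3Concentration_holds`):
`sliceAlignedOffSmallSetNotSingular_holds`; its form at an ABSOLUTE vorticity level `{|ω| > d}`, `d` arbitrary
(`sliceAlignedOffSmallSet_absLevel_not_singular`, containing the tree's ROUND-70 fixed-`δ₀` Barker–Prange
criterion as the case `E_n = ∅`); and the every-time contrapositive `DirectionalDisorderFloorSupTypeI`
(«at a sup-Type-I singularity, for every late time, every unit vector `e` and every exceptional set of scaled
measure `κ`, some high-vorticity point off the set has direction `δ₀`-far from `e`») with `_holds`.
-/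

noncomputable section

set_option linter.dupNamespace false

open MeasureTheory Set Function Filter Metric Real
open _root_.Topology
open scoped ENNReal NNReal
open Literature.Analysis Literature.Analysis.FluidPDE

namespace Summit.NavierStokesRegularity.NavierStokesRegularity.Theorems.StrainDoors

/-! ### §M34(d) Door Z CLOSED in the sup-norm Type-I class; the absolute-level form; the every-time
### directional-disorder floor -/

/-- ★★★★ **DOOR Z HOLDS** (sup-norm Type-I class, constants depending on `M, R` only): door X is closed in
the tree (`sliceL3Concentration_holds`, ROUND 70), so the reduction
`sliceAlignedOffSmallSetNotSingular_of_sliceL3Concentration` closes door Z.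
[cite: BarkerPrange2020Alignment, Thm 3 (arXiv:1906.08225 p. 18); BarkerPrange2020, Thm 2;
GigaMiura2011, Thm 1.1] -/
theorem sliceAlignedOffSmallSetNotSingular_holds : SliceAlignedOffSmallSetNotSingular :=
  sliceAlignedOffSmallSetNotSingular_of_sliceL3Concentration sliceL3Concentration_holds

/-- ★★★ **DOOR Z AT AN ABSOLUTE VORTICITY LEVEL** (the shape of Barker–Prange's `Ω_d = {|ω| > d}`): for
every `M` and `R > 0` there are `δ₀, κ > 0` such that for EVERY real `d`: alignment `|ξ(x,s_n) − e_n| ≤ δ₀`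
at the points `x ∈ B(x₀,R√(T − s_n)) ∖ E_n` with `|ω(x,s_n)| > d`, `|E_n| ≤ κ(T − s_n)^{3/2}`, `|e_n| = 1`,
along some `s_n → T`, excludes a singularity at `(T,x₀)` — because on a tail of the sequence the scaled
level `d_Z/(T − s_n)` of door Z exceeds `d`.  With `E_n = ∅` and `e_n = ξ(x_n,s_n)` at any point of `Ω_d`
this contains the tree's `sliceAligned_fixedDelta_not_singular_of_supTypeI_M_only` (ROUND 70).
[cite: BarkerPrange2020Alignment, Thm 3 (arXiv:1906.08225 p. 18); BarkerPrange2020, Thm 2] -/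
theorem sliceAlignedOffSmallSet_absLevel_not_singular (M R : ℝ) (hR : 0 < R) :
    ∃ δ₀ κ : ℝ, 0 < δ₀ ∧ 0 < κ ∧
      ∀ (d T : ℝ) (u : ℝ → EuclideanSpace ℝ (Fin 3) → EuclideanSpace ℝ (Fin 3))
        (p : ℝ → EuclideanSpace ℝ (Fin 3) → ℝ), 0 < T →
        IsClassicalNSSolutionOn (Ico 0 T) 1 0 u p → IsLerayHopfOn T 1 0 (u 0) u →
        (∀ t ∈ Ioo 0 T, ∀ x : EuclideanSpace ℝ (Fin 3), ‖u t x‖ ≤ M / Real.sqrt (T - t)) →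
        ∀ (x₀ : EuclideanSpace ℝ (Fin 3)) (s : ℕ → ℝ) (e : ℕ → EuclideanSpace ℝ (Fin 3))
          (E : ℕ → Set (EuclideanSpace ℝ (Fin 3))),
          (∀ n, s n ∈ Ioo 0 T) → Tendsto s atTop (𝓝 T) → (∀ n, ‖e n‖ = 1) →
          (∀ n, volume (E n) ≤ ENNReal.ofReal (κ * Real.sqrt (T - s n) ^ 3)) →
          (∀ n, ∀ x ∈ ball x₀ (R * Real.sqrt (T - s n)), x ∉ E n →
            d < ‖curl (u (s n)) x‖ → ‖vorticityDirection (curl (u (s n))) x - e n‖ ≤ δ₀) →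
          ¬ IsBackwardSingularPoint u (T, x₀) := by
  obtain ⟨dZ, δ₀, κ, hdZ, hδ₀, hκ, hZ⟩ := sliceAlignedOffSmallSetNotSingular_holds M R hR
  refine ⟨δ₀, κ, hδ₀, hκ, ?_⟩
  intro d T u p hT hcl hLH hI x₀ s e E hs hsT he hE hcoh
  -- a tail on which `(T − s_n) d < d_Z`
  have hprod : Tendsto (fun n => (T - s n) * d) atTop (𝓝 0) := by
    have h := (tendsto_const_nhds (x := T)).sub hsT
    rw [sub_self] at h
    simpa using h.mul_const d
  obtain ⟨N, hN⟩ := eventually_atTop.1 (hprod.eventually (Iio_mem_nhds hdZ))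
  refine hZ T u p hT hcl hLH hI x₀ (fun n => s (n + N)) (fun n => e (n + N)) (fun n => E (n + N))
    (fun n => hs _) (hsT.comp (tendsto_add_atTop_nat N)) (fun n => he _) (fun n => hE _) ?_
  intro n x hx hxE hdx
  refine hcoh (n + N) x hx hxE ?_
  have hTs : 0 < T - s (n + N) := by linarith [(hs (n + N)).2]
  have h1 : (T - s (n + N)) * d < dZ := hN (n + N) (by omega)
  by_contra hle
  push Not at hle
  have h2 : (T - s (n + N)) * ‖curl (u (s (n + N))) x‖ ≤ (T - s (n + N)) * d :=
    mul_le_mul_of_nonneg_left hle hTs.le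
  linarith

/-- ★★ **THE DIRECTIONAL-DISORDER FLOOR (statement)** — the every-time contrapositive shape of door Z
(«TYPE-I BLOW-UP NEEDS A POSITIVE SCALED MEASURE OF DIRECTIONAL DISORDER»): for every `M` and `R > 0` there
are `d, δ₀, κ > 0` such that at a singular point `(T,x₀)` of a classical, Leray–Hopf solution with the global
sup-norm Type-I bound `|u| ≤ M/√(T − t)`, for EVERY `t` near `T`, EVERY unit vector `e` and EVERY set `E` with
`|E| ≤ κ(T − t)^{3/2}`, some point of `B(x₀,R√(T − t)) ∖ E` with `(T − t)|ω(x,t)| > d` has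
`|ξ(x,t) − e| > δ₀`: the set of high-vorticity points whose direction is `δ₀`-far from `e` cannot be covered
by a set of scaled measure `κ`, whatever `e`.  Informal sources: Barker–Prange 2020 (arXiv:1906.08225) Thm 3
and Remark 5 of arXiv:2003.06717; Constantin–Fefferman 1993 §1; Giga–Miura 2011 Thm 1.1. [new-as-typed] -/
def DirectionalDisorderFloorSupTypeI : Prop :=
  ∀ M R : ℝ, 0 < R → ∃ d δ₀ κ : ℝ, 0 < d ∧ 0 < δ₀ ∧ 0 < κ ∧
    ∀ (T : ℝ) (u : ℝ → EuclideanSpace ℝ (Fin 3) → EuclideanSpace ℝ (Fin 3))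
      (p : ℝ → EuclideanSpace ℝ (Fin 3) → ℝ), 0 < T →
      IsClassicalNSSolutionOn (Ico 0 T) 1 0 u p → IsLerayHopfOn T 1 0 (u 0) u →
      (∀ t ∈ Ioo 0 T, ∀ x : EuclideanSpace ℝ (Fin 3), ‖u t x‖ ≤ M / Real.sqrt (T - t)) →
      ∀ x₀ : EuclideanSpace ℝ (Fin 3), IsBackwardSingularPoint u (T, x₀) →
        ∃ t₁ : ℝ, t₁ < T ∧ ∀ t ∈ Ioo t₁ T, ∀ e : EuclideanSpace ℝ (Fin 3), ‖e‖ = 1 →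
          ∀ E : Set (EuclideanSpace ℝ (Fin 3)), volume E ≤ ENNReal.ofReal (κ * Real.sqrt (T - t) ^ 3) →
            ∃ x ∈ ball x₀ (R * Real.sqrt (T - t)), x ∉ E ∧ d < (T - t) * ‖curl (u t) x‖ ∧
              δ₀ < ‖vorticityDirection (curl (u t)) x - e‖

/-- ★★★ **SEQUENCE FORM ⇒ EVERY-TIME FORM**: `SliceAlignedOffSmallSetNotSingular → DirectionalDisorderFloorSupTypeI`
(if the floor failed at times `s_n ∈ (T − T/(n+1), T)`, the bad slices would satisfy the hypothesis of door Z).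
[cite: BarkerPrange2020Alignment, Thm 3 (arXiv:1906.08225 p. 18)] -/
theorem directionalDisorderFloor_of_sliceAlignedOffSmallSet (hZ : SliceAlignedOffSmallSetNotSingular) :
    DirectionalDisorderFloorSupTypeI := by
  intro M R hR
  obtain ⟨d, δ₀, κ, hd, hδ₀, hκ, hZM⟩ := hZ M R hR
  refine ⟨d, δ₀, κ, hd, hδ₀, hκ, ?_⟩
  intro T u p hT hcl hLH hI x₀ hsing
  by_contra hbad
  push Not at hbad
  -- bad slices `s n → T` with unit vectors `e n` and small exceptional sets `E n`
  have hF := fun n : ℕ => hbad (T - T * (1 / ((n : ℝ) + 1)))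
    (by have : 0 < T * (1 / ((n : ℝ) + 1)) := by positivity
        linarith)
  choose s hs e he E hE hcoh using hF
  have hs0 : ∀ n, s n ∈ Ioo 0 T := by
    intro n
    refine ⟨?_, (hs n).2⟩
    have h1 : T * (1 / ((n : ℝ) + 1)) ≤ T := by
      have : 1 / ((n : ℝ) + 1) ≤ 1 := by
        rw [div_le_one (by positivity)]
        linarith [(n.cast_nonneg : (0 : ℝ) ≤ n)]
      nlinarith
    linarith [(hs n).1]
  have hsT : Tendsto s atTop (𝓝 T) := by
    have hlow : Tendsto (fun n : ℕ => T - T * (1 / ((n : ℝ) + 1))) atTop (𝓝 T) := by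
      have h := ((tendsto_one_div_add_atTop_nhds_zero_nat (𝕜 := ℝ)).const_mul T).const_sub T
      rwa [mul_zero, sub_zero] at h
    exact tendsto_of_tendsto_of_tendsto_of_le_of_le hlow tendsto_const_nhds
      (fun n => (hs n).1.le) (fun n => (hs n).2.le)
  refine hZM T u p hT hcl hLH hI x₀ s e E hs0 hsT he hE ?_ hsing
  intro n x hx hxE hdx
  exact hcoh n x hx hxE hdx

/-- ★★★★ **THE DIRECTIONAL-DISORDER FLOOR HOLDS** in the sup-norm Type-I class (constants depending on
`M, R` only). [cite: BarkerPrange2020Alignment, Thm 3 (arXiv:1906.08225 p. 18); BarkerPrange2020, Thm 2;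
GigaMiura2011, Thm 1.1] -/
theorem directionalDisorderFloorSupTypeI_holds : DirectionalDisorderFloorSupTypeI :=
  directionalDisorderFloor_of_sliceAlignedOffSmallSet sliceAlignedOffSmallSetNotSingular_holds

end Summit.NavierStokesRegularity.NavierStokesRegularity.Theorems.StrainDoors

end
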